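import Summits.CriticalPhenomena.PercolationContinuityZ3.Theorems.Transplant.FKThreeApexUCondRim
import Summits.CriticalPhenomena.PercolationContinuityZ3.Theorems.Transplant.FKDoubleFanCrossApexLeaves
import HarnessLib

/-!
# Double fans `K₂ ∨ P_{m+1}`: the CROSS-APEX ADJACENT pair `(a c_j, b c_{j+1})` — compact Rayleigh form and the normalized core inequality

Helper file (`--supports stmt-CriticalPhenomena-4575`), FK sub-lane `prim-bschramm-fk-3` (gen 25); builds on p205010 (kernel theorem, internal
audit signed; external expert review pending).  Pure real algebra, no sorries; standard axioms.  Memo `bschramm/prim-bschramm-fk-3/U-RIM.md` §4–4c.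

The last pair of ADJACENT edges of a weighted double fan not yet known to be negatively correlated for `0 < q ≤ 1` is the "generalized T5"
pair: the spoke `a c_j`, the rim edge `c_j c_{j+1}` (probability `r`), the spoke `b c_{j+1}`.  With `u ∈ InKE` the prefix and `s ∈ InKE` the reversed
suffix, the four pinned valuations are `crossZ q r u s σ τ = val(s ∗ edgeBC(τ) ∗ E_r(edgeAC(σ) ∗ u))`, and (`rayleigh_cross_eq`, by `ring`)
  `Z¹⁰Z⁰¹ − Z¹¹Z⁰⁰ = q²(1−q)·[(1−r)·N^{(bc)}(u)N^{(ac)}(s) + r(r+(1−r)q)·N^{(ab)}(u∗s) − (1−q)(2−q)·r(1−r)·C(u,s)]`,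
  `C(u,s) = κ_C(u)·I_a(s) + I_b(u)·s_ac(s_0+s_bc)`  (`I_a = −J_a`, `I_b = −J_b`, `κ_C = Z_0Z_bc + Z_0Z_1 − Z_abZ_ac`; `crossC`).
The endpoint coefficients are products of master forms (the 2-sum at `r = 0`, the same-vertex pair at `r = 1`); the mixed term is where the
upper-envelope conditions `U_b(u)`, `U_a(s)` (`…ThreeApexUCondRimStep`) are needed.  The memo reduces `≥ 0` on `InKE²` to ONE inequality for
`U`-tight ("roof") vectors, in the normalization `M_b(u) = M_a(s) = 1` with tight probes `w = ω₀(u)`, `v = ω₀(s)`, ratios `t = y/W_b(u)`,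
`t' = z'/W_a(s)` and `s = √q`.  This file proves that CORE INEQUALITY (`cross_roof_core`):
  `(1−r)(2−s²)²w²v² + r(r+(1−r)s²)·A2S ≥ (1−s²)(2−s²)·r(1−r)·CS`
by (i) the exact square `r + (1−r)s² − (1+s)²r(1−r) = (s − (1+s)r)²` and an AM–GM step without square roots, (ii) the identity
`4(1+s)²w²v²·A2S − (1−s²)²CS² = w²v²(1+s)·B` (`cxQ_identity`, `ring`) and (iii) `B ≥ 0` from SIX small polynomial leaves in `(s,w,v) ∈ [0,1]³`,
each certified by its Bernstein expansion with non-negative coefficients in `…DoubleFanCrossApexLeaves` (`cxCore00_nonneg`,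
`cxCore10_nonneg`, `cxCore20_nonneg`, `cxCore11_nonneg_aux` for `s ≤ 9/10`, `cxDisc_nonneg_aux` = `4c₂₀c₀₂ ≥ c₁₁²` for `s ≥ 9/10`).  The assembly (roof reduction by linearity in the
`u`-coordinates, the tight probe from the intermediate value theorem, the measure-level statement) is the sequel.
[cite: Grimmett2006, §3.9 eq. (3.94) (pp. 63–64)] [folklore]
-/

noncomputable section

namespace Summit.CriticalPhenomena.PercolationContinuityZ3.Theorems

namespace FK

namespace ThreeApex

/-! ### The four valuations and the compact Rayleigh form -/

/-- The pinned valuations of the cross-apex adjacent pair: `val(s ∗ edgeBC(τ) ∗ E_r(edgeAC(σ) ∗ u))`. [folklore] -/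
def crossZ (q r : ℝ) (u s : V5) (σ τ : ℝ) : ℝ := val q (conv s (conv (edgeBC τ) (rimStep q r (conv (edgeAC σ) u))))

/-- The mixed form `C(u,s) = κ_C(u)·I_a(s) + I_b(u)·s_ac(s_0 + s_bc)` (`I_a = −J_a`, `I_b(u) = −J_a(swapAB u)`, `κ_C = kap ∘ swapAB`). [folklore] -/
def crossC (u s : V5) : ℝ := kap (swapAB u) * (-jA s) + (-jA (swapAB u)) * (s.zac * (s.z0 + s.zbc))

/-- **Compact Rayleigh form of the cross-apex adjacent pair**:
`Z¹⁰Z⁰¹ − Z¹¹Z⁰⁰ = q²(1−q)[(1−r)N^{(bc)}(u)N^{(ac)}(s) + r(r+(1−r)q)N^{(ab)}(u∗s) − (1−q)(2−q)r(1−r)C(u,s)]`. [folklore] -/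
theorem rayleigh_cross_eq (q r : ℝ) (u s : V5) :
    crossZ q r u s 1 0 * crossZ q r u s 0 1 - crossZ q r u s 1 1 * crossZ q r u s 0 0 =
      q ^ 2 * (1 - q) * ((1 - r) * (masterN q (swapAB u) * masterN q s) + r * (r + (1 - r) * q) * masterN q (swapBC (conv u s))
        - (1 - q) * (2 - q) * (r * (1 - r)) * crossC u s) := by
  simp only [crossZ, crossC, val, conv, edgeBC, edgeAC, rimStep, masterN, swapAB, swapBC, kap, jA, hx, hy, hz, V5.total]
  ring

/-- The endpoint `r = 0` (rim edge deleted, a 2-sum): `N^{(bc)}(u)·N^{(ac)}(s) ≥ 0` on `InKE²`; the endpoint `r = 1` (rim edge contracted):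
`N^{(ab)}(u ∗ s) ≥ 0`.  Both need no `U`. [folklore] -/
theorem cross_endpoints_nonneg {q : ℝ} (hq0 : 0 ≤ q) (hq1 : q ≤ 1) {u s : V5} (hu : InKE q u) (hs : InKE q s) :
    0 ≤ masterN q (swapAB u) * masterN q s ∧ 0 ≤ masterN q (swapBC (conv u s)) :=
  ⟨mul_nonneg (hu.valid hq0 hq1).nBC (hs.valid hq0 hq1).nAC, ((InKE.mul hu hs).valid hq0 hq1).nAB⟩

/-! ### The normalized quantities of two `U`-tight ("roof") vectors and the core inequality -/

/-- `E(w) = 2w(1−w)` (`= (1+p)·I/M` of a roof vector with tight probe `w`). [folklore] -/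
def cxE (w : ℝ) : ℝ := 2 * w * (1 - w)

/-- `(1+p)·X W/M` of a roof vector: `(2−s²)(1−w)² + (1−s²)E(w)`. [folklore] -/
def cxXW (s w : ℝ) : ℝ := (2 - s ^ 2) * (1 - w) ^ 2 + (1 - s ^ 2) * cxE w

/-- `(1+p)·Z W/M` of a roof vector: `(2−s²)w² + (1−s²)E(w)`. [folklore] -/
def cxZW (s w : ℝ) : ℝ := (2 - s ^ 2) * w ^ 2 + (1 - s ^ 2) * cxE w

/-- The lossy lower bound `(1 + p t)(E + ((1+p) − qE)t) ≤ (1+p)·uv/M` of a roof vector. [folklore] -/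
def cxUV (s w t : ℝ) : ℝ := (1 + (1 - s ^ 2) * t) * (cxE w + ((2 - s ^ 2) - s ^ 2 * cxE w) * t)

/-- `(1+p)²·N^{(ab)}(u∗s)/(MM')` in the roof normalization, with the two `(1+p)uv/M` values as arguments `U, U'`. [folklore] -/
def cxA2S (s w v t t' U U' : ℝ) : ℝ :=
  U * (2 - s ^ 2) * (1 - v) ^ 2 + U' * (2 - s ^ 2) * (1 - w) ^ 2 + cxXW s w * cxXW s v * (1 + (1 - s ^ 2) * t) * (1 + (1 - s ^ 2) * t')
    + (1 - s ^ 2) * (cxE w + cxXW s w * t) * (cxE v + cxXW s v * t')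

/-- `(1+p)²·C(u,s)/(MM')` in the roof normalization. [folklore] -/
def cxCS (s w v t t' : ℝ) : ℝ := cxE w * cxE v + cxE w * cxZW s v * t' + cxE v * cxZW s w * t

/-- The bracket `B`: the `(t,t')`-expansion of `4(1+s)²w²v²A2S − (1−s²)²CS²` over the leaves. [folklore] -/
def cxB (s w v t t' : ℝ) : ℝ :=
  (1 - w) * (1 - v) * (1 + s) * cxCore00 s w v + (1 - v) * (1 + s) * cxCore10 s w v * t + (1 - w) * (1 + s) * cxCore10 s v w * t'
    + (1 - v) ^ 2 * (1 - s ^ 2) * s * cxCore20 s w * t ^ 2 + (1 - w) ^ 2 * (1 - s ^ 2) * s * cxCore20 s v * t' ^ 2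
    + (1 - w) * (1 - v) * (1 - s ^ 2) * s * cxCore11 s w v * (t * t')

/-- **The identity** `4(1+s)²w²v²·A2S(lossy) − (1−s²)²·CS² = w²v²(1+s)·B`. [folklore] -/
theorem cxQ_identity (s w v t t' : ℝ) :
    4 * (1 + s) ^ 2 * (w ^ 2 * v ^ 2) * cxA2S s w v t t' (cxUV s w t) (cxUV s v t') - (1 - s ^ 2) ^ 2 * cxCS s w v t t' ^ 2 =
      w ^ 2 * v ^ 2 * (1 + s) * cxB s w v t t' := by
  simp only [cxA2S, cxUV, cxCS, cxB, cxXW, cxZW, cxE, cxCore00, cxCore10, cxCore20, cxCore11]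
  ring

/-- `B ≥ 0` for `s, w, v ∈ [0,1]`, `t, t' ≥ 0`. [folklore] -/
theorem cxB_nonneg {s w v t t' : ℝ} (hs0 : 0 ≤ s) (hs1 : s ≤ 1) (hw0 : 0 ≤ w) (hw1 : w ≤ 1) (hv0 : 0 ≤ v) (hv1 : v ≤ 1)
    (ht : 0 ≤ t) (ht' : 0 ≤ t') : 0 ≤ cxB s w v t t' := by
  have hw' : 0 ≤ 1 - w := sub_nonneg.2 hw1
  have hv' : 0 ≤ 1 - v := sub_nonneg.2 hv1
  have hs' : 0 ≤ 1 - s ^ 2 := by nlinarith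
  have h00 := cxCore00_nonneg s w v hs0 hs1 hw0 hw1 hv0 hv1
  have h10 := cxCore10_nonneg s w v hs0 hs1 hw0 hw1 hv0 hv1
  have h01 := cxCore10_nonneg s v w hs0 hs1 hv0 hv1 hw0 hw1
  have h20 := cxCore20_nonneg s w hs0 hs1 hw0 hw1
  have h02 := cxCore20_nonneg s v hs0 hs1 hv0 hv1
  -- the quadratic part
  have hquad : 0 ≤ (1 - v) ^ 2 * (1 - s ^ 2) * s * cxCore20 s w * t ^ 2 + (1 - w) ^ 2 * (1 - s ^ 2) * s * cxCore20 s v * t' ^ 2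
      + (1 - w) * (1 - v) * (1 - s ^ 2) * s * cxCore11 s w v * (t * t') := by
    by_cases hs9 : s ≤ 9 / 10
    · have h11 : 0 ≤ cxCore11 s w v := by
        have := cxCore11_nonneg_aux (10 / 9 * s) w v (by positivity) (by linarith) hw0 hw1 hv0 hv1
        have e : (9 : ℝ) / 10 * (10 / 9 * s) = s := by ring
        rwa [e] at this
      positivity
    · have hs9' : 9 / 10 ≤ s := le_of_not_ge hs9
      have hd := cxDisc_nonneg_aux (10 * s - 9) w v (by linarith) (by linarith) hw0 hw1 hv0 hv1
      have e : (9 : ℝ) / 10 + (10 * s - 9) / 10 = s := by ring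
      rw [e] at hd
      have key : 0 ≤ t ^ 2 * ((1 - v) ^ 2 * cxCore20 s w) + t' ^ 2 * ((1 - w) ^ 2 * cxCore20 s v)
          + t * t' * ((1 - w) * (1 - v) * cxCore11 s w v) := by
        refine H5.quad_nonneg (by positivity) (by positivity) ?_ t t'
        have e2 : ((1 - w) * (1 - v) * cxCore11 s w v) ^ 2 = ((1 - w) ^ 2 * (1 - v) ^ 2) * cxCore11 s w v ^ 2 := by ring
        have e3 : 4 * ((1 - v) ^ 2 * cxCore20 s w) * ((1 - w) ^ 2 * cxCore20 s v) =
            ((1 - w) ^ 2 * (1 - v) ^ 2) * (4 * cxCore20 s w * cxCore20 s v) := by ring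
        rw [e2, e3]
        exact mul_le_mul_of_nonneg_left (by linarith) (by positivity)
      have e4 : (1 - v) ^ 2 * (1 - s ^ 2) * s * cxCore20 s w * t ^ 2 + (1 - w) ^ 2 * (1 - s ^ 2) * s * cxCore20 s v * t' ^ 2
          + (1 - w) * (1 - v) * (1 - s ^ 2) * s * cxCore11 s w v * (t * t') =
          ((1 - s ^ 2) * s) * (t ^ 2 * ((1 - v) ^ 2 * cxCore20 s w) + t' ^ 2 * ((1 - w) ^ 2 * cxCore20 s v)
            + t * t' * ((1 - w) * (1 - v) * cxCore11 s w v)) := by ring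
      rw [e4]; positivity
  have t1 : 0 ≤ (1 - w) * (1 - v) * (1 + s) * cxCore00 s w v := by positivity
  have t2 : 0 ≤ (1 - v) * (1 + s) * cxCore10 s w v * t := by positivity
  have t3 : 0 ≤ (1 - w) * (1 + s) * cxCore10 s v w * t' := by positivity
  simp only [cxB]
  linarith

set_option maxHeartbeats 800000 in
/-- **THE NORMALIZED CORE INEQUALITY of the cross-apex adjacent pair** (roof × roof; `s = √q`, `w, v` the tight probes of `u, s`, `t, t'` the
ratios `y/W_b`, `z'/W_a`, `U, U'` the values `(1+p)uv/M ≥` their lossy bounds, `r` the rim probability):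
`(1−s²)(2−s²)·r(1−r)·CS ≤ (1−r)(2−s²)²w²v² + r(r + (1−r)s²)·A2S`. [folklore] -/
theorem cross_roof_core {s w v t t' r U U' : ℝ} (hs0 : 0 ≤ s) (hs1 : s ≤ 1) (hw0 : 0 ≤ w) (hw1 : w ≤ 1) (hv0 : 0 ≤ v) (hv1 : v ≤ 1)
    (ht : 0 ≤ t) (ht' : 0 ≤ t') (hr0 : 0 ≤ r) (hr1 : r ≤ 1) (hU : cxUV s w t ≤ U) (hU' : cxUV s v t' ≤ U') :
    (1 - s ^ 2) * (2 - s ^ 2) * (r * (1 - r)) * cxCS s w v t t' ≤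
      (1 - r) * (2 - s ^ 2) ^ 2 * (w ^ 2 * v ^ 2) + r * (r + (1 - r) * s ^ 2) * cxA2S s w v t t' U U' := by
  have hw' : 0 ≤ 1 - w := sub_nonneg.2 hw1
  have hv' : 0 ≤ 1 - v := sub_nonneg.2 hv1
  have hr' : 0 ≤ 1 - r := sub_nonneg.2 hr1
  have hp : 0 ≤ 1 - s ^ 2 := by nlinarith
  have hp1 : 0 ≤ 2 - s ^ 2 := by nlinarith
  have hq2 : 0 ≤ (2 - s ^ 2) - s ^ 2 * cxE w := by
    have : cxE w ≤ 1 := by simp only [cxE]; nlinarith [sq_nonneg (2 * w - 1)]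
    have : 0 ≤ cxE w := by simp only [cxE]; positivity
    nlinarith
  have hE : 0 ≤ cxE w := by simp only [cxE]; positivity
  have hE' : 0 ≤ cxE v := by simp only [cxE]; positivity
  have hXW : 0 ≤ cxXW s w := by simp only [cxXW]; positivity
  have hXW' : 0 ≤ cxXW s v := by simp only [cxXW]; positivity
  have hZW : 0 ≤ cxZW s w := by simp only [cxZW]; positivity
  have hZW' : 0 ≤ cxZW s v := by simp only [cxZW]; positivity
  have hCS : 0 ≤ cxCS s w v t t' := by simp only [cxCS]; positivity
  have hUV : 0 ≤ cxUV s w t := by simp only [cxUV]; positivity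
  -- monotonicity of A2S in U, U'
  have hmono : cxA2S s w v t t' (cxUV s w t) (cxUV s v t') ≤ cxA2S s w v t t' U U' := by
    simp only [cxA2S]
    have h1 : cxUV s w t * (2 - s ^ 2) * (1 - v) ^ 2 ≤ U * (2 - s ^ 2) * (1 - v) ^ 2 :=
      mul_le_mul_of_nonneg_right (mul_le_mul_of_nonneg_right hU hp1) (by positivity)
    have h2 : cxUV s v t' * (2 - s ^ 2) * (1 - w) ^ 2 ≤ U' * (2 - s ^ 2) * (1 - w) ^ 2 :=
      mul_le_mul_of_nonneg_right (mul_le_mul_of_nonneg_right hU' hp1) (by positivity)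
    linarith
  have hA2 : 0 ≤ cxA2S s w v t t' (cxUV s w t) (cxUV s v t') := by
    have hUV' : 0 ≤ cxUV s v t' := by
      have hq2' : 0 ≤ (2 - s ^ 2) - s ^ 2 * cxE v := by
        have : cxE v ≤ 1 := by simp only [cxE]; nlinarith [sq_nonneg (2 * v - 1)]
        nlinarith
      simp only [cxUV]; positivity
    simp only [cxA2S]; positivity
  -- (ii)+(iii): 4(1+s)² A0 A2S ≥ (1−s²)² CS²
  have hQ : (1 - s ^ 2) ^ 2 * cxCS s w v t t' ^ 2 ≤ 4 * (1 + s) ^ 2 * (w ^ 2 * v ^ 2) * cxA2S s w v t t' U U' := by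
    have hB := cxB_nonneg hs0 hs1 hw0 hw1 hv0 hv1 ht ht'
    have e := cxQ_identity s w v t t'
    have : 0 ≤ w ^ 2 * v ^ 2 * (1 + s) * cxB s w v t t' := by positivity
    have : 4 * (1 + s) ^ 2 * (w ^ 2 * v ^ 2) * cxA2S s w v t t' (cxUV s w t) (cxUV s v t') ≤
        4 * (1 + s) ^ 2 * (w ^ 2 * v ^ 2) * cxA2S s w v t t' U U' := mul_le_mul_of_nonneg_left hmono (by positivity)
    linarith
  -- (i): the r-step, on opaque names `X, Y, K`
  obtain ⟨X, hX⟩ : ∃ X : ℝ, X = (1 - r) * (2 - s ^ 2) ^ 2 * (w ^ 2 * v ^ 2) := ⟨_, rfl⟩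
  obtain ⟨Y, hY⟩ : ∃ Y : ℝ, Y = r * (r + (1 - r) * s ^ 2) * cxA2S s w v t t' U U' := ⟨_, rfl⟩
  obtain ⟨K, hK⟩ : ∃ K : ℝ, K = (1 - s ^ 2) * (2 - s ^ 2) * (r * (1 - r)) * cxCS s w v t t' := ⟨_, rfl⟩
  obtain ⟨A, hA⟩ : ∃ A : ℝ, A = cxA2S s w v t t' U U' := ⟨_, rfl⟩
  obtain ⟨G, hG⟩ : ∃ G : ℝ, G = cxCS s w v t t' := ⟨_, rfl⟩
  rw [← hK, ← hX, ← hY]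
  have hA2U : 0 ≤ A := by rw [hA]; exact le_trans hA2 hmono
  have hGn : 0 ≤ G := by rw [hG]; exact hCS
  rw [← hA] at hY hQ
  rw [← hG] at hK hQ
  have hXn : 0 ≤ X := by rw [hX]; positivity
  have hYn : 0 ≤ Y := by rw [hY]; positivity
  have hrho : (1 + s) ^ 2 * (r * (1 - r)) ≤ r + (1 - r) * s ^ 2 := by
    have e : r + (1 - r) * s ^ 2 - (1 + s) ^ 2 * (r * (1 - r)) = (s - (1 + s) * r) ^ 2 := by ring
    nlinarith [sq_nonneg (s - (1 + s) * r), e]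
  have h4 : K ^ 2 ≤ 4 * X * Y := by
    have e1 : 4 * X * Y = (2 - s ^ 2) ^ 2 * (r * (1 - r)) * (r + (1 - r) * s ^ 2) * (4 * (w ^ 2 * v ^ 2) * A) := by
      rw [hX, hY]; ring
    have e2 : K ^ 2 = (2 - s ^ 2) ^ 2 * (r * (1 - r)) ^ 2 * ((1 - s ^ 2) ^ 2 * G ^ 2) := by rw [hK]; ring
    rw [e1, e2]
    have hc : 0 ≤ (2 - s ^ 2) ^ 2 * (r * (1 - r)) := by positivity
    have hd : 0 ≤ 4 * (w ^ 2 * v ^ 2) * A := by positivity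
    have step1 : (2 - s ^ 2) ^ 2 * (r * (1 - r)) ^ 2 * ((1 - s ^ 2) ^ 2 * G ^ 2) ≤
        (2 - s ^ 2) ^ 2 * (r * (1 - r)) ^ 2 * (4 * (1 + s) ^ 2 * (w ^ 2 * v ^ 2) * A) :=
      mul_le_mul_of_nonneg_left hQ (by positivity)
    have step2 : (2 - s ^ 2) ^ 2 * (r * (1 - r)) ^ 2 * (4 * (1 + s) ^ 2 * (w ^ 2 * v ^ 2) * A) =
        (2 - s ^ 2) ^ 2 * (r * (1 - r)) * ((1 + s) ^ 2 * (r * (1 - r))) * (4 * (w ^ 2 * v ^ 2) * A) := by ring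
    have step3 : (2 - s ^ 2) ^ 2 * (r * (1 - r)) * ((1 + s) ^ 2 * (r * (1 - r))) * (4 * (w ^ 2 * v ^ 2) * A) ≤
        (2 - s ^ 2) ^ 2 * (r * (1 - r)) * (r + (1 - r) * s ^ 2) * (4 * (w ^ 2 * v ^ 2) * A) :=
      mul_le_mul_of_nonneg_right (mul_le_mul_of_nonneg_left hrho hc) hd
    linarith
  have h5 : K ^ 2 ≤ (X + Y) ^ 2 := by
    have e : (X + Y) ^ 2 = 4 * X * Y + (X - Y) ^ 2 := by ring
    rw [e]; nlinarith [sq_nonneg (X - Y)]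
  exact (abs_le_of_sq_le_sq' h5 (add_nonneg hXn hYn)).2

end ThreeApex

end FK

end Summit.CriticalPhenomena.PercolationContinuityZ3.Theorems
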